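/-
COR-CM (cell pub-hodgecm2) — RSCONJ row Ω (A7, the ω-LABEL face of the μ ↦ μᶜ identification), ROUTE C
(`HOME/d2bridge/ident/ident-1/omega/OMEGA-ROUTE-C.md`): the θ-TWIST `g ↦ ḡ` of the unitary dual-pair Weil carriers is
TRANSPORT OF STRUCTURE along the anti-symplectic involution `Λ : (x, y) ↦ (x, −y)` of `𝕎_𝔸 = 𝔸ⁿ × 𝔸ⁿ`, which the tree
already implements as the relabelling `adelicMpContRelabel (C := −1)` (✔ `Weil1964/AdelicMetaplecticTransport`).
Seat prover-pub-hodgeaudit-ident-1-g3-0 (ident-1 GEN 3), checker ident-2, 2026-08-24.  PART I OF 3 (RecordSystemConjOmegaTwist).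
KERNEL ONLY: definitions by explicit formula + theorems; no named fact, no instance, no `sorry`.  HC_CM is NOT proved;
HELD — WORLD = C FINAL; nothing displayed by an END is discharged here.
-/
import Literature.NumberTheory.Automorphic.Liu2021.Def411WeilCarriersAtLine
import Summits.HodgeConjecture.CorCM.D2Bridge.UnitaryGroupFinAdelicConj
import HarnessLib

set_option autoImplicit false

/-!
# The θ-twist of the unitary dual-pair Weil carriers, I: the relabelling `Λ`, the conjugation `g ↦ ḡ`, Weil's rational lifts

Setting of [GelbartRogawski1991, §3.1] ∕ [Liu2021, Def. 4.11] as typed in the tree: `E/F` quadratic (`c`), an `F`-rational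
symmetric Gram matrix `T_V` (`J_V = T_V ⊗ 1`), the hermitian LINES `⟨a⟩`, `a ∈ Fˣ` (`TW F a`, `JW F E a`), the Gram matrix
`𝕋_a = adelicGram e T_V (TW a)` of `Res(V ⊗ ⟨a⟩)` and the metaplectic group of record `Mp_ψ(W_{𝕋_a})ᶜᵒⁿᵗ`.

* §1 `𝕋_{−a} = −𝕋_a` (`adelicGram_neg_line`) and **`relabelNeg a : Mp_ψ(W_{𝕋_{−a}})ᶜᵒⁿᵗ ≃* Mp_ψ(W_{𝕋_a})ᶜᵒⁿᵗ`**,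
  `(g, M) ↦ (Λ g Λ⁻¹, M)` along `Λ = relabelVec (−1) : (x, y) ↦ (x, −y)` (✔ `adelicMpContRelabel`): SAME operator
  (`omega_relabelNeg`), projection conjugated by `Λ` (`proj_relabelNeg`), Θ-fixing preserved.
* §2 entrywise conjugation `pairConj : g ↦ ḡ` on the big pair group `G₁(𝔸) = U(J_V ⊗ J_W)(𝔸)` for `F`-rational `J_V, J_W`,
  and `adelicPair_neg`: the pair groups of `(J_V, J_W)` and `(J_V, −J_W)` COINCIDE.
* §3 Weil's rational lifts at `±a`: (R0) `symplecticGroupCongr_ratSp_neg_line` — `Λ ratSp_{𝕋_{−a}}(A) Λ⁻¹ = ratSp_{𝕋_a}(A)` with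
  the SAME matrix `A` (the Darboux maps `(x, y) ↦ (x, T y)` absorb the sign); (R1) `relabelNeg_ratThetaLiftCont` —
  `R_a (r_{−a}(A)) = r_a(A)` by Θ-rigidity; `relabelNeg_mem_range_ratSection` — `R_a` carries Weil's section `i_{−a}` into `i_a`.

Parts II ∕ III (`…OmegaTwistCompatible`, `…OmegaTwistCarriers`): the transported splitting family `s′_a := R_a ∘ s_{−a} ∘ (g ↦ ḡ)` is
[GR91]-compatible, and Liu's carriers satisfy `ω(s_{−a}; −a; χ⁻¹) ∘ (k ↦ k̄) ≅ ω(s′_a; a; χ)` ℂ-linearly.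

References: [GelbartRogawski1991] §3.1 p. 454–457; [Weil1964] Chap. I n° 4–5, Chap. III n° 37–41; [MoeglinVignerasWaldspurger1987]
Chap. 2 II.1; [Kudla1996] V.3 (`W⁻`, `Sp(W) = Sp(W⁻)`); [PlatonovRapinchuk1994] §5.1; [Liu2021] Def. 4.11–4.12, Rem. 4.4, App. D §D.1.
-/

noncomputable section

open scoped Matrix Kronecker
open NumberField IsDedekindDomain
open Literature.RepresentationTheory.HeisenbergGroup
open Literature.NumberTheory.Automorphic Literature.NumberTheory.Automorphic.UnitaryGroup
open Literature.NumberTheory.Weil1964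
open Literature.NumberTheory.GelbartRogawski1991 Literature.NumberTheory.GelbartRogawski1991.UnitaryDualPair
open Literature.NumberTheory.GelbartRogawski1991.UnitaryDualPair.WeilCoinv
open Literature.RepresentationTheory
open Literature.NumberTheory.Automorphic.Liu2021.Def411WeilCarriers (TW JW JW_eq isSymm_TW isUnit_det_TW Chi lineChar
  lineChar_finAdelicCenter lineCenterEquiv lineCenterEquiv_apply IsAutomorphicOneChar omegaAtLine rhoVAtLine)

namespace Summit.HodgeConjecture.CorCM.HComp.OmegaConj

/-! ## §1 The Gram matrices at `±a` and the relabelling `Λ = (x, y) ↦ (x, −y)` -/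

section Gram

variable (F : Type) [Field F] [NumberField F] {N n : ℕ} (e : Fin N × Fin 1 ≃ Fin n) (TV : Matrix (Fin N) (Fin N) F)

/-- `A ⊗ₖ (−B) = −(A ⊗ₖ B)`. [folklore] -/
theorem kronecker_neg_right {R : Type*} [CommRing R] {l m p q : Type*} (A : Matrix l m R) (B : Matrix p q R) :
    A ⊗ₖ (-B) = -(A ⊗ₖ B) := by
  ext ⟨i, i'⟩ ⟨j, j'⟩
  simp [Matrix.kroneckerMap_apply, mul_neg]

omit [NumberField F] in
/-- `TW (−a) = −TW a`. [cite: Liu2021, App. D §D.1 Step 1 (l. 5215)] -/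
theorem TW_neg (a : Fˣ) : TW F (-a) = -TW F a := by
  ext i j
  fin_cases i; fin_cases j
  simp [TW, Units.val_neg]

/-- **`𝕋_{−a} = −𝕋_a`**: the Gram matrix of `Res(V ⊗ ⟨−a⟩)` is minus that of `Res(V ⊗ ⟨a⟩)`. [cite: Kudla1996, V.3] -/
theorem adelicGram_neg_line (a : Fˣ) : adelicGram F e TV (TW F (-a)) = -adelicGram F e TV (TW F a) := by
  rw [adelicGram, adelicGram, TW_neg, Matrix.map_neg _ (map_neg _), kronecker_neg_right]
  rfl

/-- the relabelling hypothesis `𝕋_a · (−1) = 𝕋_{−a}` of `adelicMpContRelabel (C := −1)`. [cite: Kudla1996, V.3] -/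
theorem adelicGram_mul_neg_one (a : Fˣ) :
    adelicGram F e TV (TW F a) * ((-1 : GL (Fin n) (AdeleRing (𝓞 F) F)) : Matrix (Fin n) (Fin n) (AdeleRing (𝓞 F) F)) =
      adelicGram F e TV (TW F (-a)) := by
  rw [adelicGram_neg_line, Units.val_neg, Units.val_one, Matrix.mul_neg, Matrix.mul_one]

/-- **`R_a : Mp_ψ(W_{𝕋_{−a}})ᶜᵒⁿᵗ ≃* Mp_ψ(W_{𝕋_a})ᶜᵒⁿᵗ`**, `(g, M) ↦ (Λ g Λ⁻¹, M)` along `Λ = relabelVec (−1) : (x, y) ↦ (x, −y)`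
(✔ `adelicMpContRelabel`): the SAME operator, the symplectic element conjugated by the anti-symplectic involution `Λ`.
[cite: MoeglinVignerasWaldspurger1987, Chap. 2 II.1] [cite: Kudla1996, V.3] -/
def relabelNeg (a : Fˣ) :
    adelicMpCont F (Fin n) (adelicGram F e TV (TW F (-a))) ≃* adelicMpCont F (Fin n) (adelicGram F e TV (TW F a)) :=
  adelicMpContRelabel F (Fin n) (T := adelicGram F e TV (TW F a)) (T' := adelicGram F e TV (TW F (-a)))
    (-1) (adelicGram_mul_neg_one F e TV a)

/-- `Λ⁻¹ = Λ` (`(−1)⁻¹ = −1`). [folklore] -/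
theorem relabelVec_neg_one_symm_apply (v : (Fin n → AdeleRing (𝓞 F) F) × (Fin n → AdeleRing (𝓞 F) F)) :
    (relabelVec F (Fin n) (-1)).symm v = relabelVec F (Fin n) (-1) v := by
  have h1 : ((-1 : GL (Fin n) (AdeleRing (𝓞 F) F))⁻¹ : GL (Fin n) (AdeleRing (𝓞 F) F)) = -1 :=
    inv_eq_of_mul_eq_one_right (by rw [neg_mul_neg, one_mul])
  rw [relabelVec_symm_apply, relabelVec_apply, h1]

end Gram

/-! ## §2 Entrywise conjugation on the groups of the pair -/

section Groups

variable (F E : Type) [Field F] [NumberField F] [Field E] [NumberField E] [Algebra F E]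
variable (c : E ≃ₐ[F] E) (N M : ℕ)

omit [NumberField F] in
/-- `U(σ, −J) = U(σ, J)`. [folklore] -/
theorem unitaryGroupOfForm_neg {R : Type*} [CommRing R] {m : Type*} [Fintype m] [DecidableEq m] (σ : R →+* R)
    (J : Matrix m m R) : unitaryGroupOfForm σ (-J) = unitaryGroupOfForm σ J := by
  ext g
  rw [mem_unitaryGroupOfForm_iff, mem_unitaryGroupOfForm_iff, Matrix.mul_neg, Matrix.neg_mul, neg_inj]

omit [NumberField F] in
/-- the adelic form matrix of an `F`-RATIONAL Gram matrix is fixed by `c ⊗ 1`. [folklore] -/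
theorem adelicForm_map_conjAdele {TV : Matrix (Fin N) (Fin N) F} {JV : Matrix (Fin N) (Fin N) E}
    (hJV : JV = TV.map (algebraMap F E)) :
    (UnitaryGroup.adelicForm E N JV).map (conjAdele F E c) = UnitaryGroup.adelicForm E N JV := by
  rw [UnitaryGroup.adelicForm, hJV, Matrix.map_map, Matrix.map_map, Matrix.map_map]
  congr 1
  funext t
  simp only [Function.comp_apply]
  rw [← algebraMap_conj, RingHom.coe_coe, AlgEquiv.commutes]

variable {TV : Matrix (Fin N) (Fin N) F} {TW : Matrix (Fin M) (Fin M) F}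
  {JV : Matrix (Fin N) (Fin N) E} {JW : Matrix (Fin M) (Fin M) E}
  (hJV : JV = TV.map (algebraMap F E)) (hJW : JW = TW.map (algebraMap F E))

omit [NumberField F] in
/-- the pair form `J_V ⊗ J_W ⊗ 1` is fixed by `c ⊗ 1`. [folklore] -/
theorem pairForm_map_conjAdele (hJV : JV = TV.map (algebraMap F E)) (hJW : JW = TW.map (algebraMap F E)) :
    (UnitaryGroup.adelicForm E N JV ⊗ₖ UnitaryGroup.adelicForm E M JW).map (conjAdele F E c) =
      UnitaryGroup.adelicForm E N JV ⊗ₖ UnitaryGroup.adelicForm E M JW := by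
  rw [← kronecker_map_map, adelicForm_map_conjAdele F E c N hJV, adelicForm_map_conjAdele F E c M hJW]

/-- **`g ↦ ḡ = (c ⊗ 1) g` on `G₁(𝔸_F) = U(J_V ⊗ J_W)(𝔸_F)`** for `F`-rational `J_V`, `J_W` (the defining equation is
preserved because `c` fixes the form). [cite: PlatonovRapinchuk1994, §5.1] -/
def pairConj : adelicPair F E c N M JV JW →* adelicPair F E c N M JV JW where
  toFun g := ⟨Matrix.GeneralLinearGroup.map (conjAdele F E c) g.1, by
    have h := map_mem_unitaryGroupOfForm (conjAdele F E c) (τ := conjAdele F E c) (fun _ => rfl) g.2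
    rwa [pairForm_map_conjAdele F E c N M hJV hJW] at h⟩
  map_one' := Subtype.ext (map_one _)
  map_mul' g g' := Subtype.ext (map_mul _ _ _)

omit [NumberField F] in
/-- underlying matrix of `pairConj g`: `GL(c ⊗ 1) g`. [folklore] -/
@[simp] theorem coe_pairConj (g : adelicPair F E c N M JV JW) :
    ((pairConj F E c N M hJV hJW g : adelicPair F E c N M JV JW) : GL (Fin N × Fin M) (AdeleRing (𝓞 E) E)) =
      Matrix.GeneralLinearGroup.map (conjAdele F E c) g := rfl

omit [NumberField F] in
/-- entries of `pairConj g`: `c ⊗ 1` applied entrywise. [folklore] -/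
theorem coe_pairConj_apply (g : adelicPair F E c N M JV JW) (i j : Fin N × Fin M) :
    ((pairConj F E c N M hJV hJW g : adelicPair F E c N M JV JW) : GL (Fin N × Fin M) (AdeleRing (𝓞 E) E)).1 i j =
      conjAdele F E c ((g : GL (Fin N × Fin M) (AdeleRing (𝓞 E) E)).1 i j) := rfl

omit [NumberField F] in
/-- **`G₁` does not see the sign of `J_W`**: `U(J_V ⊗ (−J_W))(𝔸) = U(J_V ⊗ J_W)(𝔸)`. [cite: Kudla1996, V.3] -/
theorem adelicPair_neg (JV : Matrix (Fin N) (Fin N) E) (JW : Matrix (Fin M) (Fin M) E) :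
    adelicPair F E c N M JV (-JW) = adelicPair F E c N M JV JW := by
  have h : UnitaryGroup.adelicForm E M (-JW) = -UnitaryGroup.adelicForm E M JW :=
    Matrix.map_neg _ (map_neg (algebraMap E (AdeleRing (𝓞 E) E))) JW
  rw [adelicPair, adelicPair, h, kronecker_neg_right, unitaryGroupOfForm_neg]

end Groups

/-! ## §3 Weil's rational lifts at `±a` under the relabelling `Λ` -/

section RationalLift

open Literature.RepresentationTheory.HeisenbergGroup.SymplecticMatrix

variable (F : Type) [Field F] [NumberField F] {N n : ℕ} (e : Fin N × Fin 1 ≃ Fin n) {TV : Matrix (Fin N) (Fin N) F}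
  (hVd : IsUnit TV.det)

/-- `ω(R_a p) = ω(p)`: the relabelling does not move the Weil operator (✔ `adelicMpCont.omega_relabel`).
[cite: MoeglinVignerasWaldspurger1987, Chap. 2 II.1] -/
theorem omega_relabelNeg (a : Fˣ) (p : adelicMpCont F (Fin n) (adelicGram F e TV (TW F (-a)))) :
    adelicMpCont.omega F (Fin n) (adelicGram F e TV (TW F a)) (relabelNeg F e TV a p) =
      adelicMpCont.omega F (Fin n) (adelicGram F e TV (TW F (-a))) p :=
  adelicMpCont.omega_relabel F (Fin n) (-1) (adelicGram_mul_neg_one F e TV a) p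

/-- `π(R_a p) = Λ π(p) Λ⁻¹` (✔ `adelicMpCont.proj_relabel`). [cite: MoeglinVignerasWaldspurger1987, Chap. 2 II.1] -/
theorem proj_relabelNeg (a : Fˣ) (p : adelicMpCont F (Fin n) (adelicGram F e TV (TW F (-a)))) :
    adelicMpCont.proj F (Fin n) (adelicGram F e TV (TW F a)) (relabelNeg F e TV a p) =
      symplecticGroupCongr (polar (adelicForm F (Fin n) (adelicGram F e TV (TW F (-a)))))
        (polar (adelicForm F (Fin n) (adelicGram F e TV (TW F a)))) (relabelVec F (Fin n) (-1))
        (polar_relabelVec F (Fin n) (-1) (adelicGram_mul_neg_one F e TV a))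
        (adelicMpCont.proj F (Fin n) (adelicGram F e TV (TW F (-a))) p) :=
  adelicMpCont.proj_relabel F (Fin n) (-1) (adelicGram_mul_neg_one F e TV a) p

/-- `R_a` preserves Θ-fixing (✔ `coe_adelicMpContRelabel_mem_adelicMpTheta_iff`). [cite: Weil1964, Chap. III n° 41 Thm 6 p. 193] -/
theorem coe_relabelNeg_mem_adelicMpTheta_iff (a : Fˣ) (p : adelicMpCont F (Fin n) (adelicGram F e TV (TW F (-a)))) :
    ((relabelNeg F e TV a p : adelicMpCont F (Fin n) (adelicGram F e TV (TW F a))) :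
        adelicMp F (Fin n) (adelicGram F e TV (TW F a))) ∈ adelicMpTheta F (Fin n) (adelicGram F e TV (TW F a)) ↔
      (p : adelicMp F (Fin n) (adelicGram F e TV (TW F (-a)))) ∈ adelicMpTheta F (Fin n) (adelicGram F e TV (TW F (-a))) :=
  coe_adelicMpContRelabel_mem_adelicMpTheta_iff F (Fin n) (-1) (adelicGram_mul_neg_one F e TV a) p

/-- `(𝕋_{−a})⁻¹ = −𝕋_a⁻¹`. [cite: Kudla1996, V.3] -/
theorem inv_adelicGram_neg_line (hVd : IsUnit TV.det) (a : Fˣ) :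
    (adelicGram F e TV (TW F (-a)))⁻¹ = -(adelicGram F e TV (TW F a))⁻¹ := by
  rw [adelicGram_neg_line]
  exact Matrix.inv_eq_left_inv (by
    rw [neg_mul_neg, Matrix.nonsing_inv_mul _ (isUnit_det_adelicGram F e hVd (isUnit_det_TW F a))])

/-- **(R0) the rational symplectic groups at `±a` correspond under `Λ` WITH THE SAME MATRIX**: the Darboux transports
`(x, y) ↦ (x, T y)` of `𝕋_{−a} = −𝕋_a` and `𝕋_a` absorb the sign, `Λ (ratSp_{𝕋_{−a}} A) Λ⁻¹ = ratSp_{𝕋_a} A`.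
[cite: Weil1964, Chap. III n° 37 p. 188] [cite: Kudla1996, V.3] -/
theorem symplecticGroupCongr_ratSp_neg_line (a : Fˣ) (A : Matrix.symplecticGroup (Fin n) F) :
    symplecticGroupCongr (polar (adelicForm F (Fin n) (adelicGram F e TV (TW F (-a)))))
        (polar (adelicForm F (Fin n) (adelicGram F e TV (TW F a)))) (relabelVec F (Fin n) (-1))
        (polar_relabelVec F (Fin n) (-1) (adelicGram_mul_neg_one F e TV a))
        (ratSp F (adelicGram F e TV (TW F (-a))) (isUnit_det_adelicGram F e hVd (isUnit_det_TW F (-a))) A) =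
      ratSp F (adelicGram F e TV (TW F a)) (isUnit_det_adelicGram F e hVd (isUnit_det_TW F a)) A := by
  refine Subtype.ext (LinearEquiv.ext fun v => ?_)
  rw [coe_symplecticGroupCongr_apply, relabelVec_neg_one_symm_apply, ratSp, ratSp, MonoidHom.comp_apply,
    MonoidHom.comp_apply, coe_transportSp_apply, coe_transportSp_apply, SymplecticMatrix.darboux_apply,
    SymplecticMatrix.darboux_apply, SymplecticMatrix.darboux_symm_apply, SymplecticMatrix.darboux_symm_apply, relabelVec_apply, relabelVec_apply, inv_adelicGram_neg_line F e hVd]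
  simp only [Units.val_neg, Units.val_one, Matrix.neg_mulVec, Matrix.one_mulVec, neg_neg, adelicGram_neg_line,
    Matrix.mulVec_neg]

/-- **(R1) `R_a (r_{𝕋_{−a}}(A)) = r_{𝕋_a}(A)`** — Weil's Θ-fixing rational lifts at `±a` correspond under the relabelling,
by Θ-RIGIDITY (✔ `coe_ratThetaLiftCont_eq`): `R_a` preserves Θ-fixing and lies over `ratSp_{𝕋_a} A` by (R0).
[cite: Weil1964, Chap. III n° 40 p. 190, n° 41 Thm 6 p. 193] -/
theorem relabelNeg_ratThetaLiftCont (a : Fˣ) (A : Matrix.symplecticGroup (Fin n) F) :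
    relabelNeg F e TV a (ratThetaLiftCont F (adelicGram F e TV (TW F (-a)))
        (isUnit_det_adelicGram F e hVd (isUnit_det_TW F (-a))) A) =
      ratThetaLiftCont F (adelicGram F e TV (TW F a)) (isUnit_det_adelicGram F e hVd (isUnit_det_TW F a)) A := by
  refine Subtype.ext (coe_ratThetaLiftCont_eq F (adelicGram F e TV (TW F a))
    (isUnit_det_adelicGram F e hVd (isUnit_det_TW F a)) ?_ ?_).symm
  · exact (coe_relabelNeg_mem_adelicMpTheta_iff F e a _).2
      (coe_ratThetaLiftCont_mem_adelicMpTheta F (adelicGram F e TV (TW F (-a)))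
        (isUnit_det_adelicGram F e hVd (isUnit_det_TW F (-a))) A)
  · rw [← adelicMpCont.proj_apply, proj_relabelNeg, proj_ratThetaLiftCont, symplecticGroupCongr_ratSp_neg_line F e hVd]

set_option maxHeartbeats 1600000 in
-- (the `𝕋_{±a}`-instances of the Θ-lift are expensive to compare in `isDefEq` — cf. the same note in
-- ✔ `AdelicMetaplecticRationalLiftConj`; term mode, explicit witness, generous budget)
/-- **`R_a` carries the rational section `i_{−a}` into the range of `i_a`** (the `ratPts` clause of compatibility).
[cite: GelbartRogawski1991, §3.1 p. 454 L40–42] [cite: Weil1964, Chap. III n° 41 Thm 6 p. 193] -/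
theorem relabelNeg_mem_range_ratSection (a : Fˣ) (p : adelicMpCont F (Fin n) (adelicGram F e TV (TW F (-a))))
    (hp : p ∈ (ratSection F (adelicGram F e TV (TW F (-a))) (isUnit_det_adelicGram F e hVd (isUnit_det_TW F (-a)))).range) :
    relabelNeg F e TV a p ∈
      (ratSection F (adelicGram F e TV (TW F a)) (isUnit_det_adelicGram F e hVd (isUnit_det_TW F a))).range :=
  Exists.elim (MonoidHom.mem_range.1 hp) fun x hx =>
    Exists.elim (MonoidHom.mem_range.1 x.2) fun A hA =>
      have hxA : x = ⟨ratSp F (adelicGram F e TV (TW F (-a))) (isUnit_det_adelicGram F e hVd (isUnit_det_TW F (-a))) A,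
          A, rfl⟩ := Subtype.ext hA.symm
      MonoidHom.mem_range.2
        ⟨⟨ratSp F (adelicGram F e TV (TW F a)) (isUnit_det_adelicGram F e hVd (isUnit_det_TW F a)) A, A, rfl⟩,
          (ratSection_apply F _ _ A).trans ((relabelNeg_ratThetaLiftCont F e hVd a A).symm.trans
            (congrArg (relabelNeg F e TV a)
              ((ratSection_apply F _ _ A).symm.trans ((congrArg _ hxA).symm.trans hx))))⟩

end RationalLift

end Summit.HodgeConjecture.CorCM.HComp.OmegaConj

end
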